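import Mathlib
import HarnessLib
import Literature.Analysis.FluidPDE.SuitableWeak
import Literature.Analysis.FluidPDE.SelfSimilar
import Literature.Analysis.FluidPDE.LocalTypeI
import Literature.Analysis.FluidPDE.SpaceTimeRescaling
import Literature.Analysis.FluidPDE.LocalTypeIScaling
import Literature.Analysis.FluidPDE.LocalTypeICongr
import Literature.Analysis.FluidPDE.LocalTypeIReverseZoom
import Literature.Analysis.FluidPDE.SlabTypeICompactness
import Literature.Analysis.FluidPDE.TypeIRateOseenMildRepresentative
import Summits.NavierStokesRegularity.NavierStokesRegularity.Theorems.RellichScarApexLocalisationSpherePersistence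
import Summits.NavierStokesRegularity.NavierStokesRegularity.Theorems.RecurrentProfilesRecurrentReductionOrbit

/-!
# Normalisation tools: continuous representative and Navier–Stokes rescaling of a rate-Type-I
# slab profile with uniformly weak-`L³` slices
# (line russian-doll-multiplicity of crux `RellichScar.ApexLocalisation`, stub `stub_rdNormalise`)

Two bookkeeping tools of the doll theorem `rd_weakL3Localisation` (hypotheses h6a/h6b).

* `rdNormalise_repr` (part (a)).  A suitable weak solution `(u, p)` of Navier–Stokes (`ν = 1`,
  `f = 0`) on the backward slab `𝕊 = (-∞, 0) × ℝ³` with weak gradient `G`, Albritton–Barker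
  quantity `𝐈(ℝ³ × ℝ₋) < ⊤`, the Type-I rate `‖u(t,x)‖ ≤ C/√(−t)`, a backward-singular origin and
  the weak-`L³` slice bound `h³ |{x : h < ‖u(t,x)‖}| ≤ M` for ALL `t < 0`, `h > 0`, is a.e. equal
  on the slab to its continuous Oseen-mild representative `v`
  (`exists_oseenMild_repr_of_typeIBound_lt_top`, the slab form of Albritton–Barker 2019,
  Thm. 1.1, forward direction), which keeps the rate.  Suitability, the gradient, `𝐈` and the
  singular origin are transferred along the a.e. equality (`IsSuitableWeakSolutionOn.congr_ae`,
  `HasWeakSpatialGradientOn.congr_ae`, `typeIBound_congr_ae`, `IsBackwardSingularPoint.congr_ae`);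
  by Fubini `u(t, ·) = v(t, ·)` a.e. for a.e. `t < 0`, and for such `t` the super-level sets of
  `‖u(t, ·)‖` and `‖v(t, ·)‖` agree up to null sets, so the slice bound holds for a.e. `t < 0`.
* `rdNormalise_rescale` (part (b)).  The Navier–Stokes rescaling about the space–time origin,
  `v_ρ(t, x) = ρ v(ρ² t, ρ x) = (ρ • stPull (ρ²) ρ 0 0 v)(t, x)` (`ρ > 0`), of a continuous class
  profile singular at the origin with the a.e. slice bound is again one, with the SAME constants
  `C, M, I`: suitability, gradient and `𝐈` by `zoom_slabProfile` (covariance of suitable weak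
  solutions, scale invariance of `𝐈`), continuity and the rate by `continuousOn_hullImage`,
  `hasTypeITimeDecay_hullImage`, the singular origin by `isBackwardSingularPoint_zoom`; the slice
  bound is scale invariant, `|{x : h < ρ ‖v(ρ² t, ρ x)‖}| = ρ⁻³ |{x' : h/ρ < ‖v(ρ² t, x')‖}|`
  (`Measure.addHaar_preimage_smul`), and "a.e. `t`" is transported along `t ↦ ρ² t`
  (`Real.map_volume_mul_left`: a quasi-measure-preserving map of `ℝ`).

The registered stub `stub_rdNormalise` is the conjunction `⟨rdNormalise_repr, rdNormalise_rescale⟩`.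

## References

* D. Albritton, T. Barker, *On local Type I singularities of the Navier–Stokes equations and
  Liouville theorems*, J. Math. Fluid Mech. 21 (2019) = arXiv:1811.00502, Thm. 1.1, §3
  ("by translating in space-time and rescaling"). [cite: AlbrittonBarker2019, §3]
* G. Koch, N. Nadirashvili, G. Seregin, V. Šverák, Acta Math. 203 (2009), (1.4). [KNSS2009]
-/

noncomputable section

set_option linter.dupNamespace false

namespace Summit.NavierStokesRegularity.NavierStokesRegularity.Theorems.RellichScarApexLocalisation

open MeasureTheory Set Function Metric Filter Topology TopologicalSpace
open scoped ENNReal NNReal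
open Literature.Analysis Literature.Analysis.FluidPDE

local notation "E³" => EuclideanSpace ℝ (Fin 3)

/-- The open backward slab `(-∞, 0) × ℝ³` (time first). -/
local notation "𝕊" => Literature.Analysis.FluidPDE.slab (EuclideanSpace ℝ (Fin 3)) (Set.Iio (0 : ℝ)) isOpen_Iio

/-! ### Part (a): the continuous representative keeps the weak-`L³` slice bound for a.e. `t` -/

/-- **An a.e. equality on the slab is, for a.e. time, an a.e. equality of the slices** (Fubini:
`volume` on `ℝ × ℝ³` is the product measure). -/
theorem rdNormalise_ae_slice_eq {u v : ℝ → E³ → E³}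
    (hae : ∀ᵐ w ∂(volume.restrict (Iio (0 : ℝ) ×ˢ (univ : Set E³))), uncurry u w = uncurry v w) :
    ∀ᵐ t : ℝ, t < 0 → ∀ᵐ x : E³, u t x = v t x := by
  have h1 : ∀ᵐ z ∂(volume : Measure (ℝ × E³)), z ∈ Iio (0 : ℝ) ×ˢ (univ : Set E³) →
      uncurry u z = uncurry v z :=
    (ae_restrict_iff' (measurableSet_Iio.prod MeasurableSet.univ)).1 hae
  rw [Measure.volume_eq_prod] at h1
  filter_upwards [Measure.ae_ae_of_ae_prod h1] with t ht htneg
  filter_upwards [ht] with x hx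
  exact hx ⟨htneg, mem_univ _⟩

/-- **The weak-`L³` slice bound passes along an a.e. equality on the slab, for a.e. `t < 0`**:
if `u = v` a.e. on `(-∞, 0) × ℝ³` and `h³ |{x : h < ‖u(t,x)‖}| ≤ M` for all `t < 0`, `h > 0`,
then the same holds for `v` at a.e. `t < 0` (the super-level sets of a.e. equal slices agree up
to null sets). -/
theorem rdNormalise_slice_bound_congr_ae {u v : ℝ → E³ → E³} {M : ℝ}
    (hae : ∀ᵐ w ∂(volume.restrict (Iio (0 : ℝ) ×ˢ (univ : Set E³))), uncurry u w = uncurry v w)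
    (hslice : ∀ t : ℝ, t < 0 → ∀ h : ℝ, 0 < h →
      ENNReal.ofReal (h ^ 3) * volume {x : E³ | h < ‖u t x‖} ≤ ENNReal.ofReal M) :
    ∀ᵐ t : ℝ, t < 0 → ∀ h : ℝ, 0 < h →
      ENNReal.ofReal (h ^ 3) * volume {x : E³ | h < ‖v t x‖} ≤ ENNReal.ofReal M := by
  filter_upwards [rdNormalise_ae_slice_eq hae] with t ht htneg h hh
  have hset : {x : E³ | h < ‖v t x‖} =ᵐ[volume] {x : E³ | h < ‖u t x‖} := by
    refine Filter.eventuallyEq_set.2 ?_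
    filter_upwards [ht htneg] with x hx
    rw [hx]
  rw [measure_congr hset]
  exact hslice t htneg h hh

/-- **Part (a): the continuous (Oseen-mild) representative of a rate-Type-I singular slab profile
with `𝐈 < ⊤`, keeping the weak-`L³` slice bound for a.e. `t < 0`.**  The representative is that of
`exists_oseenMild_repr_of_typeIBound_lt_top` (slab form of Albritton–Barker 2019, Thm. 1.1, forward
direction); the class data are transferred along the a.e. equality and the slice bound by Fubini.
[cite: AlbrittonBarker2019, Thm 1.1 and §3] -/
theorem rdNormalise_repr :
    ∀ (C M : ℝ) (u : ℝ → E³ → E³) (p : ℝ → E³ → ℝ) (G : ℝ → E³ → E³ →L[ℝ] E³),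
      IsSuitableWeakSolutionOn 𝕊 1 0 u p → HasWeakSpatialGradientOn 𝕊 u G →
      typeIBound (Iio (0 : ℝ) ×ˢ univ) u p G < ⊤ → HasTypeITimeDecay C u →
      IsBackwardSingularPoint u 0 →
      (∀ t : ℝ, t < 0 → ∀ h : ℝ, 0 < h →
        ENNReal.ofReal (h ^ 3) * volume {x : E³ | h < ‖u t x‖} ≤ ENNReal.ofReal M) →
      ∃ v : ℝ → E³ → E³,
        IsSuitableWeakSolutionOn 𝕊 1 0 v p ∧ HasWeakSpatialGradientOn 𝕊 v G ∧
        typeIBound (Iio (0 : ℝ) ×ˢ univ) v p G < ⊤ ∧ HasTypeITimeDecay C v ∧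
        ContinuousOn (uncurry v) (Iio (0 : ℝ) ×ˢ univ) ∧ IsBackwardSingularPoint v 0 ∧
        (∀ᵐ t : ℝ, t < 0 → ∀ h : ℝ, 0 < h →
          ENNReal.ofReal (h ^ 3) * volume {x : E³ | h < ‖v t x‖} ≤ ENNReal.ofReal M) := by
  intro C M u p G hsw hwg hI hC hsing hslice
  obtain ⟨v, hae, hcont, -, -, hCv⟩ := exists_oseenMild_repr_of_typeIBound_lt_top hsw hC hI
  have hae' : ∀ᵐ w ∂(volume.restrict ((𝕊 : Opens (ℝ × E³)) : Set (ℝ × E³))),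
      uncurry u w = uncurry v w := by
    rw [coe_slab]
    exact hae
  refine ⟨v, hsw.congr_ae hae' (ae_of_all _ fun _ => rfl), hwg.congr_ae hae', ?_, hCv, hcont,
    hsing.congr_ae (fun r _ => parabolicCylinder_origin_subset_slab r) hae,
    rdNormalise_slice_bound_congr_ae hae hslice⟩
  rwa [← typeIBound_congr_ae hae]

/-! ### Part (b): Navier–Stokes rescaling of the whole package -/

/-- **Scale invariance of the weak-`L³` slice quantity**: for `ρ > 0`, `t : ℝ` and `h > 0`,
`h³ |{x : h < ‖(ρ • stPull (ρ²) ρ 0 0 v)(t, x)‖}| = (h/ρ)³ |{x' : h/ρ < ‖v(ρ² t, x')‖}|`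
(`{x : h < ρ ‖v(ρ²t, ρ x)‖} = ρ⁻¹ • {x' : h/ρ < ‖v(ρ²t, x')‖}` has measure `ρ⁻³ |·|`,
`Measure.addHaar_preimage_smul`). -/
theorem rdNormalise_slice_rescale (v : ℝ → E³ → E³) {ρ : ℝ} (hρ : 0 < ρ) (t : ℝ) {h : ℝ}
    (hh : 0 < h) :
    ENNReal.ofReal (h ^ 3) * volume {x : E³ | h < ‖(ρ • stPull (ρ ^ 2) ρ 0 0 v) t x‖} =
      ENNReal.ofReal ((h / ρ) ^ 3) * volume {x : E³ | h / ρ < ‖v (ρ ^ 2 * t) x‖} := by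
  have hset : {x : E³ | h < ‖(ρ • stPull (ρ ^ 2) ρ 0 0 v) t x‖} =
      (fun x : E³ => ρ • x) ⁻¹' {x' : E³ | h / ρ < ‖v (ρ ^ 2 * t) x'‖} := by
    ext x
    simp only [mem_setOf_eq, mem_preimage, smul_stPull_apply, zero_add, norm_smul,
      Real.norm_of_nonneg hρ.le, div_lt_iff₀' hρ]
  rw [hset, Measure.addHaar_preimage_smul volume hρ.ne', finrank_euclideanSpace_fin, ← mul_assoc,
    ← ENNReal.ofReal_mul (by positivity)]
  have e : h ^ 3 * |(ρ ^ 3)⁻¹| = (h / ρ) ^ 3 := by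
    rw [abs_of_pos (inv_pos.2 (pow_pos hρ 3)), div_pow, div_eq_mul_inv]
  rw [e]

/-- **The weak-`L³` slice bound for a.e. `t < 0` is invariant under the Navier–Stokes rescaling
about the origin** (scale invariance of the slice quantity, and `t ↦ ρ² t` is quasi-measure
preserving on `ℝ`, `Real.map_volume_mul_left`). -/
theorem rdNormalise_slice_bound_rescale {v : ℝ → E³ → E³} {M ρ : ℝ} (hρ : 0 < ρ)
    (hslice : ∀ᵐ t : ℝ, t < 0 → ∀ h : ℝ, 0 < h →
      ENNReal.ofReal (h ^ 3) * volume {x : E³ | h < ‖v t x‖} ≤ ENNReal.ofReal M) :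
    ∀ᵐ t : ℝ, t < 0 → ∀ h : ℝ, 0 < h →
      ENNReal.ofReal (h ^ 3) * volume {x : E³ | h < ‖(ρ • stPull (ρ ^ 2) ρ 0 0 v) t x‖} ≤
        ENNReal.ofReal M := by
  have hρ2 : 0 < ρ ^ 2 := by positivity
  have hqmp : Measure.QuasiMeasurePreserving (fun t : ℝ => ρ ^ 2 * t) volume volume :=
    ⟨measurable_const_mul _, by
      rw [Real.map_volume_mul_left hρ2.ne']
      exact Measure.smul_absolutelyContinuous⟩
  filter_upwards [hqmp.ae hslice] with t ht htneg h hh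
  rw [rdNormalise_slice_rescale v hρ t hh]
  exact ht (mul_neg_of_pos_of_neg hρ2 htneg) (h / ρ) (div_pos hh hρ)

/-- **Part (b): the Navier–Stokes rescaling `ρ v(ρ² t, ρ x)` (`ρ > 0`) of a continuous class
profile singular at the origin with the a.e. weak-`L³` slice bound is again one, with the same
constants `C, M, I`** (covariance of suitable weak solutions and of weak gradients, scale
invariance of `𝐈` on `ℝ³ × ℝ₋` — `zoom_slabProfile` —, of the rate, of the singular origin —
`isBackwardSingularPoint_zoom` — and of the slice quantity).
[cite: AlbrittonBarker2019, §3] -/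
theorem rdNormalise_rescale :
    ∀ (C M : ℝ) (I : ℝ≥0∞) (ρ : ℝ) (v : ℝ → E³ → E³) (q : ℝ → E³ → ℝ)
      (H : ℝ → E³ → E³ →L[ℝ] E³),
      0 < ρ → IsSuitableWeakSolutionOn 𝕊 1 0 v q → HasWeakSpatialGradientOn 𝕊 v H →
      typeIBound (Iio (0 : ℝ) ×ˢ univ) v q H ≤ I → HasTypeITimeDecay C v →
      ContinuousOn (uncurry v) (Iio (0 : ℝ) ×ˢ univ) → IsBackwardSingularPoint v 0 →
      (∀ᵐ t : ℝ, t < 0 → ∀ h : ℝ, 0 < h →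
        ENNReal.ofReal (h ^ 3) * volume {x : E³ | h < ‖v t x‖} ≤ ENNReal.ofReal M) →
      IsSuitableWeakSolutionOn 𝕊 1 0 (ρ • stPull (ρ ^ 2) ρ 0 0 v) (ρ ^ 2 • stPull (ρ ^ 2) ρ 0 0 q) ∧
      HasWeakSpatialGradientOn 𝕊 (ρ • stPull (ρ ^ 2) ρ 0 0 v) (ρ ^ 2 • stPull (ρ ^ 2) ρ 0 0 H) ∧
      typeIBound (Iio (0 : ℝ) ×ˢ univ) (ρ • stPull (ρ ^ 2) ρ 0 0 v) (ρ ^ 2 • stPull (ρ ^ 2) ρ 0 0 q)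
        (ρ ^ 2 • stPull (ρ ^ 2) ρ 0 0 H) ≤ I ∧
      HasTypeITimeDecay C (ρ • stPull (ρ ^ 2) ρ 0 0 v) ∧
      ContinuousOn (uncurry (ρ • stPull (ρ ^ 2) ρ 0 0 v)) (Iio (0 : ℝ) ×ˢ univ) ∧
      IsBackwardSingularPoint (ρ • stPull (ρ ^ 2) ρ 0 0 v) 0 ∧
      (∀ᵐ t : ℝ, t < 0 → ∀ h : ℝ, 0 < h →
        ENNReal.ofReal (h ^ 3) * volume {x : E³ | h < ‖(ρ • stPull (ρ ^ 2) ρ 0 0 v) t x‖} ≤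
          ENNReal.ofReal M) := by
  intro C M I ρ v q H hρ hsw hwg hI hC hcont hsing hslice
  obtain ⟨hsw', hwg', hIeq⟩ := zoom_slabProfile hsw hwg hρ
  exact ⟨hsw', hwg', hIeq.trans_le hI, hasTypeITimeDecay_hullImage hC le_rfl hρ,
    continuousOn_hullImage hcont le_rfl hρ, isBackwardSingularPoint_zoom hsing hρ,
    rdNormalise_slice_bound_rescale hρ hslice⟩

/-! ### The stub -/

/-- **S6 (stub_rdNormalise), tools.** (a) A rate-Type-I suitable weak slab profile with `𝐈 < ⊤`, singular
origin and the weak-`L³` slice bound has an a.e.-equal CONTINUOUS representative (the Oseen-mild one,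
`exists_oseenMild_repr_of_typeIBound_lt_top`) with the same data, the slice bound holding for a.e.
`t < 0` (Fubini); (b) the Navier–Stokes rescaling `ρ w(ρ² t, ρ x)` of a continuous class profile singular at
the origin with the a.e. slice bound is again one, same constants (`zoom_isSuitableWeakSolutionOn`,
`typeIBound_lowerHalf_nsZoom`, `isBackwardSingularPoint_zoom`; the slice bound is scale-invariant because
`|ρ⁻¹ S| = ρ⁻³ |S|`). [cite: AlbrittonBarker2019, §3] -/
theorem stub_rdNormalise :
    (∀ (C M : ℝ) (u : ℝ → E³ → E³) (p : ℝ → E³ → ℝ) (G : ℝ → E³ → E³ →L[ℝ] E³),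
      IsSuitableWeakSolutionOn 𝕊 1 0 u p → HasWeakSpatialGradientOn 𝕊 u G →
      typeIBound (Iio (0 : ℝ) ×ˢ univ) u p G < ⊤ → HasTypeITimeDecay C u →
      IsBackwardSingularPoint u 0 →
      (∀ t : ℝ, t < 0 → ∀ h : ℝ, 0 < h →
        ENNReal.ofReal (h ^ 3) * volume {x : E³ | h < ‖u t x‖} ≤ ENNReal.ofReal M) →
      ∃ v : ℝ → E³ → E³,
        IsSuitableWeakSolutionOn 𝕊 1 0 v p ∧ HasWeakSpatialGradientOn 𝕊 v G ∧
        typeIBound (Iio (0 : ℝ) ×ˢ univ) v p G < ⊤ ∧ HasTypeITimeDecay C v ∧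
        ContinuousOn (uncurry v) (Iio (0 : ℝ) ×ˢ univ) ∧ IsBackwardSingularPoint v 0 ∧
        (∀ᵐ t : ℝ, t < 0 → ∀ h : ℝ, 0 < h →
          ENNReal.ofReal (h ^ 3) * volume {x : E³ | h < ‖v t x‖} ≤ ENNReal.ofReal M)) ∧
    (∀ (C M : ℝ) (I : ℝ≥0∞) (ρ : ℝ) (v : ℝ → E³ → E³) (q : ℝ → E³ → ℝ)
      (H : ℝ → E³ → E³ →L[ℝ] E³),
      0 < ρ → IsSuitableWeakSolutionOn 𝕊 1 0 v q → HasWeakSpatialGradientOn 𝕊 v H →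
      typeIBound (Iio (0 : ℝ) ×ˢ univ) v q H ≤ I → HasTypeITimeDecay C v →
      ContinuousOn (uncurry v) (Iio (0 : ℝ) ×ˢ univ) → IsBackwardSingularPoint v 0 →
      (∀ᵐ t : ℝ, t < 0 → ∀ h : ℝ, 0 < h →
        ENNReal.ofReal (h ^ 3) * volume {x : E³ | h < ‖v t x‖} ≤ ENNReal.ofReal M) →
      IsSuitableWeakSolutionOn 𝕊 1 0 (ρ • stPull (ρ ^ 2) ρ 0 0 v) (ρ ^ 2 • stPull (ρ ^ 2) ρ 0 0 q) ∧
      HasWeakSpatialGradientOn 𝕊 (ρ • stPull (ρ ^ 2) ρ 0 0 v) (ρ ^ 2 • stPull (ρ ^ 2) ρ 0 0 H) ∧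
      typeIBound (Iio (0 : ℝ) ×ˢ univ) (ρ • stPull (ρ ^ 2) ρ 0 0 v) (ρ ^ 2 • stPull (ρ ^ 2) ρ 0 0 q)
        (ρ ^ 2 • stPull (ρ ^ 2) ρ 0 0 H) ≤ I ∧
      HasTypeITimeDecay C (ρ • stPull (ρ ^ 2) ρ 0 0 v) ∧
      ContinuousOn (uncurry (ρ • stPull (ρ ^ 2) ρ 0 0 v)) (Iio (0 : ℝ) ×ˢ univ) ∧
      IsBackwardSingularPoint (ρ • stPull (ρ ^ 2) ρ 0 0 v) 0 ∧
      (∀ᵐ t : ℝ, t < 0 → ∀ h : ℝ, 0 < h →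
        ENNReal.ofReal (h ^ 3) * volume {x : E³ | h < ‖(ρ • stPull (ρ ^ 2) ρ 0 0 v) t x‖} ≤
          ENNReal.ofReal M)) := by
  exact ⟨rdNormalise_repr, rdNormalise_rescale⟩

end Summit.NavierStokesRegularity.NavierStokesRegularity.Theorems.RellichScarApexLocalisation

end
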